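import Mathlib
import HarnessLib
import Literature.NumberTheory.Transcendental.DrinfeldAssociatorIsGroupLikeProofs
import Literature.NumberTheory.Transcendental.DrinfeldAssociatorPentagonProofs
import Literature.NumberTheory.Transcendental.MultipleZetaRepeatedTwosProofs
import Summits.KontsevichZagierPeriods.KontsevichZagierPeriods.Theorems.FurushoPentagonKernelModuloPeriodConjectureShuffleDepthOne
import Summits.KontsevichZagierPeriods.KontsevichZagierPeriods.Theorems.FurushoPentagonKernelModuloPeriodConjectureEulerRecursion
import Summits.KontsevichZagierPeriods.KontsevichZagierPeriods.Theorems.FurushoPentagonKernelModuloPeriodConjectureNewtonPiY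
import Summits.KontsevichZagierPeriods.KontsevichZagierPeriods.Theorems.FurushoPentagonKernelModuloPeriodConjectureEvenDepthOneLeaf

/-!
# `KernelModuloPeriodConjecture`, line `Sketch`: Euler's formula for associators, closed form

Crux `FurushoPentagon.KernelModuloPeriodConjecture` (stmt-KontsevichZagierPeriods-15058), line
`Sketch` (lead c3). The registered stubs of skeleton v8 give, for every `n ≥ 1`, ONE rational `r_n`
with `c_{x₀^{2n-1}x₁}(φ) = r_n · c_{(x₀x₁)ⁿ}(φ)` at every group-like solution `φ` of Drinfeld's
pentagon equation over every commutative `ℚ`-algebra (`stub_evenDepthOneLeaf`, fed with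
`stub_shuffleDepthOne`, `stub_eulerRecursion`, `stub_newtonPiY`). Evaluating at the real Drinfeld
associator `Φ_KZ` (`c_{binaryWord s}(Φ_KZ) = (-1)^{|s|} ζ(s)`, Euler's `ζ(2n) = (-1)^{n+1} 2^{2n-1}
B_{2n} π^{2n}/(2n)!` and Hoffman's `ζ({2}ⁿ) = π^{2n}/(2n+1)!`) pins the constant down:

  `c_{(2n)}(φ) = (2n+1) 2^{2n-1} B_{2n} · c_{({2}ⁿ)}(φ)`   (`stub_evenZetaBernoulli`, registered sub-goal),

i.e. **Euler's formula holds for every associator**: `ζ_φ(2n) = (-1)^{n+1} (2n+1) 2^{2n-1} B_{2n} ζ_φ(2,…,2)`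
in the normalisation `ζ_φ(s) = (-1)^{|s|} c_{binaryWord s}(φ)` (`n = 2`: `3 c_{(4)} = -4 c_{(2,2)}`, the
tree's `pentagon_weight_four_ratio`). For Drinfeld associators with the hexagon this is classical
(Drinfeld 1990: the even depth-one coefficients are `μ`-determined); here it is derived from the
pentagon alone through Furusho's double shuffle and Gangl–Kaneko–Zagier's parity theorem.

References: [GanglKanekoZagier2006] §2 Thm 1; [Furusho2011] Thm 1.2; [Brown2012] §3.3 (3.7), Lemma 3.4;
[Hoffman1992] Cor. 2.3.
-/

noncomputable section

namespace Summit.KontsevichZagierPeriods.FurushoPentagon.KernelModuloPeriodConjecture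

open Literature.NumberTheory.Transcendental
open Real

/-- The admissible index `(2n)`, `n ≥ 1`. [folklore] -/
theorem evenDepthOne_isAdmissible {n : ℕ} (hn : 1 ≤ n) : MZV.IsAdmissible [2 * n] :=
  ⟨fun i hi => by simp at hi; omega, fun _ => by simp; omega⟩

/-- **Euler's formula for associators, closed form**: for every `n ≥ 1` and every group-like
solution `φ` of Drinfeld's pentagon equation over a commutative `ℚ`-algebra,
`c_{(2n)}(φ) = (2n+1) 2^{2n-1} B_{2n} · c_{({2}ⁿ)}(φ)` — the universal rational of
`stub_evenDepthOneLeaf` evaluated at `Φ_KZ` by Euler's and Hoffman's evaluations of `ζ(2n)` and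
`ζ(2,…,2)`. [cite: GanglKanekoZagier2006, §2 Thm 1] -/
theorem stub_evenZetaBernoulli :
    ∀ n : ℕ, 1 ≤ n → ∀ (R : Type) [CommRing R] [Algebra ℚ R] (φ : NCSeries Bool R), NCSeries.IsGroupLike φ → NCSeries.DrinfeldPentagon φ → φ (MZV.binaryWord [2 * n]) = ((2 * n + 1) * 2 ^ (2 * n - 1) * bernoulli (2 * n) : ℚ) • φ (MZV.binaryWord (List.replicate n 2)) := by
  intro n hn
  obtain ⟨r, hr⟩ :=
    stub_evenDepthOneLeaf stub_shuffleDepthOne stub_eulerRecursion stub_newtonPiY n hn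
  -- evaluate at the real Drinfeld associator
  have hΦ := hr ℝ drinfeldAssociator drinfeldAssociator_isGroupLike_holds
    drinfeldAssociator_pentagon_holds
  rw [drinfeldAssociator_binaryWord (evenDepthOne_isAdmissible hn),
    drinfeldAssociator_binaryWord (MZV.isAdmissible_replicate_two n), List.length_singleton,
    List.length_replicate, multipleZeta_two_mul_eq (k := n) (by omega),
    multipleZeta_replicate_two n, Rat.smul_def] at hΦ
  have hpi : (π : ℝ) ^ (2 * n) ≠ 0 := pow_ne_zero _ Real.pi_ne_zero
  have hf1 : ((2 * n).factorial : ℝ) ≠ 0 := by positivity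
  have hf2 : ((2 * n + 1).factorial : ℝ) ≠ 0 := by positivity
  have hfac : ((2 * n + 1).factorial : ℝ) = (2 * n + 1) * ((2 * n).factorial : ℝ) := by
    rw [Nat.factorial_succ]; push_cast; ring
  have hX : ((-1 : ℝ) ^ n * (π ^ (2 * n) / ((2 * n + 1).factorial : ℝ))) ≠ 0 :=
    mul_ne_zero (pow_ne_zero _ (by norm_num)) (div_ne_zero hpi hf2)
  have hc : ((((2 * n + 1) * 2 ^ (2 * n - 1) * bernoulli (2 * n) : ℚ)) : ℝ) *
      ((-1 : ℝ) ^ n * (π ^ (2 * n) / ((2 * n + 1).factorial : ℝ))) =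
      (-1 : ℝ) ^ 1 * ((-1) ^ (n + 1) * 2 ^ (2 * n - 1) * π ^ (2 * n) * (bernoulli (2 * n) : ℝ) /
        ((2 * n).factorial : ℝ)) := by
    push_cast
    rw [hfac]
    field_simp
    ring
  have hr' : (r : ℝ) = ((((2 * n + 1) * 2 ^ (2 * n - 1) * bernoulli (2 * n) : ℚ)) : ℝ) :=
    mul_right_cancel₀ hX (hΦ.symm.trans hc.symm)
  intro R _ _ φ hg h5
  rw [hr R φ hg h5, Rat.cast_injective hr']

end Summit.KontsevichZagierPeriods.FurushoPentagon.KernelModuloPeriodConjecture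

end
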